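import Literature.NumberTheory.Automorphic.UnitaryGroupArchimedeanPlaces
import HarnessLib

/-!
# The archimedean element `(g, 1) ∈ U(J)(𝔸_F)` read at a complex place: `σ_w((g, 1)_∞) = g_w`

Topic `NumberTheory/Automorphic`; namespace `Literature.NumberTheory.Automorphic.UnitaryGroup` (companion of
`UnitaryGroupArchimedean` — `archToAdelic : U(J)(E ⊗ ℝ) →* U(J)(𝔸_F)`, `g ↦ (g, 1)` — and
`UnitaryGroupArchimedeanPlaces` — the place components `archAt w : U(J)(E ⊗ ℝ) →* U(σ_w J)(ℂ)`).  KERNEL ONLY: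
proved bookkeeping lemmas; no new notion, no named fact, no `sorry`.

For `g ∈ U(J)(E ⊗ ℝ)` the adelic matrix of `(g, 1)` has archimedean part `g` transported to `GL_N(E_∞)`
(`E_∞ = ∏_{w∣∞} E_w`, Mathlib `InfiniteAdeleRing E`, transport `InfiniteAdeleRing.ringEquiv_mixedSpace`) and finite
part `1` [BorelJacquet1979, §4.1: `G(𝔸) = G_∞ × G(𝔸_f)`, `G_∞ = ∏_{v∣∞} G(F_v)`]:

* `extensionEmbedding_ringEquiv_mixedSpace_symm` — the complex coordinate at a complex place `w` of the transport
  `E ⊗ ℝ → E_∞`: `σ_w((e⁻¹ m)_w) = m_w` (`σ_w = Completion.extensionEmbedding w : E_w → ℂ`);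
* `map_fst_coe_archToAdelic` ∕ `map_snd_coe_archToAdelic` — `(g, 1)_∞ = e⁻¹(g)` and `(g, 1)_f = 1` entrywise;
* **`map_placeEval_coe_archToAdelic`** — reading the adelic matrix of `(g, 1)` through
  `𝔸_E → E_∞ → E_w → ℂ` gives the matrix of the place component `g_w = archAt w g ∈ U(σ_w J)(ℂ)`.
  Consequently every polynomial matrix functional (a determinant, a block determinant such as Kudla's
  `x(p) = det(p|_Δ)`) of `(g, 1)` has `w`-coordinate the same functional of `g_w`.

Written for the archimedean places of the kernel construction of [GelbartRogawski1991, Prop. 3.1.1] (stage-1 cell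
`pub-hodgecm`, seat GR-3: `χ(det_Δ (g,1)) = ∏_w χ_w(det_Δ g_w)`); nothing here is a claim of the manuscripts
adjudicated by that cell.

## References

* A. Borel, H. Jacquet, *Automorphic forms and automorphic representations*, PSPM 33.1 (1979), §4.1 [BorelJacquet1979].
-/

set_option autoImplicit false

noncomputable section

open NumberField NumberField.InfinitePlace

open scoped MatrixGroups

namespace Literature.NumberTheory.Automorphic.UnitaryGroup

open NumberField.mixedEmbedding

section MixedSpace

variable (E : Type) [Field E]

/-- **`σ_w((e⁻¹ m)_w) = m_w`**: at a complex place `w`, the `w`-component of the transport `e⁻¹ : E ⊗ ℝ → E_∞ =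
∏_{w∣∞} E_w` (`e = InfiniteAdeleRing.ringEquiv_mixedSpace E`) followed by `σ_w : E_w → ℂ` is the `w`-coordinate of
`E ⊗ ℝ = ℝ^{r₁} × ℂ^{r₂}` (Mathlib: the complex coordinates of `e` ARE the `σ_w`, definitionally).
[cite: BorelJacquet1979, §4.1] -/
theorem extensionEmbedding_ringEquiv_mixedSpace_symm [NumberField E] (m : mixedSpace E) (w : {w : InfinitePlace E // w.IsComplex}) :
    Completion.extensionEmbedding w.1 (((InfiniteAdeleRing.ringEquiv_mixedSpace E).symm m) w.1) = m.2 w := by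
  have h : (InfiniteAdeleRing.ringEquiv_mixedSpace E ((InfiniteAdeleRing.ringEquiv_mixedSpace E).symm m)).2 w =
      m.2 w := by
    rw [RingEquiv.apply_symm_apply]
  exact h

/-- the same for the `w`-coordinate ring homomorphism `evalC w`. [cite: BorelJacquet1979, §4.1] -/
theorem extensionEmbedding_ringEquiv_mixedSpace_symm_eq_evalC [NumberField E] (m : mixedSpace E)
    (w : {w : InfinitePlace E // w.IsComplex}) :
    Completion.extensionEmbedding w.1 (((InfiniteAdeleRing.ringEquiv_mixedSpace E).symm m) w.1) = evalC E w m :=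
  extensionEmbedding_ringEquiv_mixedSpace_symm E m w

end MixedSpace

section Arch

variable (F E : Type) [Field F] [NumberField F] [Field E] [NumberField E] [Algebra F E]
  (c : E ≃ₐ[F] E) (N : ℕ) (J : Matrix (Fin N) (Fin N) E)

/-- **`(g, 1)_∞ = e⁻¹(g)`**: the archimedean part of the adelic matrix of `archToAdelic g` is `g` transported
entrywise along `e⁻¹ : E ⊗ ℝ → E_∞` (tree `map_fst_ofInfinite`). [cite: BorelJacquet1979, §4.1] -/
theorem map_fst_coe_archToAdelic (g : arch F E c N J) :
    (((archToAdelic F E c N J g).1 : GL (Fin N) (AdeleRing (𝓞 E) E)) : Matrix (Fin N) (Fin N) (AdeleRing (𝓞 E) E)).map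
        (adeleFst E) =
      (((g : arch F E c N J) : GL (Fin N) (mixedSpace E)) : Matrix (Fin N) (Fin N) (mixedSpace E)).map
        (InfiniteAdeleRing.ringEquiv_mixedSpace E).symm.toRingHom :=
  map_fst_ofInfinite E N (g : GL (Fin N) (mixedSpace E))

/-- **`(g, 1)_f = 1`**: the finite part of the adelic matrix of `archToAdelic g` is the identity (tree
`map_snd_ofInfinite`). [cite: BorelJacquet1979, §4.1] -/
theorem map_snd_coe_archToAdelic (g : arch F E c N J) :
    (((archToAdelic F E c N J g).1 : GL (Fin N) (AdeleRing (𝓞 E) E)) : Matrix (Fin N) (Fin N) (AdeleRing (𝓞 E) E)).map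
        (adeleSnd E) = 1 :=
  map_snd_ofInfinite E N (g : GL (Fin N) (mixedSpace E))

/-- entries of the adelic matrix of `(g, 1)`: `(e⁻¹ g_{ij}, δ_{ij})`. [cite: BorelJacquet1979, §4.1] -/
theorem coe_archToAdelic_apply (g : arch F E c N J) (i j : Fin N) :
    (((archToAdelic F E c N J g).1 : GL (Fin N) (AdeleRing (𝓞 E) E)) : Matrix (Fin N) (Fin N) (AdeleRing (𝓞 E) E))
        i j =
      ((InfiniteAdeleRing.ringEquiv_mixedSpace E).symm
          ((((g : arch F E c N J) : GL (Fin N) (mixedSpace E)) : Matrix (Fin N) (Fin N) (mixedSpace E)) i j),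
        (1 : Matrix (Fin N) (Fin N) (IsDedekindDomain.FiniteAdeleRing (𝓞 E) E)) i j) :=
  GLn.coe_ofInfinite_apply (g : GL (Fin N) (mixedSpace E)) i j

/-- **`σ_w((g, 1)) = g_w`**: mapping the adelic matrix of `(g, 1) = archToAdelic g` entrywise through
`𝔸_E → E_∞ → E_w → ℂ` (`adeleFst`, evaluation at `w`, `σ_w = extensionEmbedding w`) at a complex place `w` fixed
by `c ≠ 1` yields the matrix of the place component `archAt w g ∈ U(σ_w J)(ℂ)`.  Hence every polynomial matrix
functional of `(g, 1)` (determinants, block determinants) has `w`-coordinate the same functional of `g_w`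
(`RingHom.map_det` and its relatives). [cite: BorelJacquet1979, §4.1] -/
theorem map_placeEval_coe_archToAdelic (w : {w : InfinitePlace E // w.IsComplex}) (hw : c • w.1 = w.1)
    (hc : c ≠ 1) (g : arch F E c N J) :
    (((archToAdelic F E c N J g).1 : GL (Fin N) (AdeleRing (𝓞 E) E)) : Matrix (Fin N) (Fin N) (AdeleRing (𝓞 E) E)).map
        ((Completion.extensionEmbedding w.1).comp
          ((Pi.evalRingHom (fun v : InfinitePlace E => v.Completion) w.1).comp (adeleFst E))) =
      (((archAt F E c N J w hw hc g : archLocal E N J w) : GL (Fin N) ℂ) : Matrix (Fin N) (Fin N) ℂ) := by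
  ext i j
  rw [Matrix.map_apply, coe_archToAdelic_apply, coe_archAt_apply]
  exact extensionEmbedding_ringEquiv_mixedSpace_symm E _ w

/-- determinant form of the previous lemma: `σ_w(det (g, 1)_∞) = det g_w`. [cite: BorelJacquet1979, §4.1] -/
theorem extensionEmbedding_det_coe_archToAdelic (w : {w : InfinitePlace E // w.IsComplex}) (hw : c • w.1 = w.1)
    (hc : c ≠ 1) (g : arch F E c N J) :
    Completion.extensionEmbedding w.1
        (((((archToAdelic F E c N J g).1 : GL (Fin N) (AdeleRing (𝓞 E) E)) :
            Matrix (Fin N) (Fin N) (AdeleRing (𝓞 E) E)).det).1 w.1) =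
      (((archAt F E c N J w hw hc g : archLocal E N J w) : GL (Fin N) ℂ) : Matrix (Fin N) (Fin N) ℂ).det := by
  rw [← map_placeEval_coe_archToAdelic F E c N J w hw hc g, ← RingHom.mapMatrix_apply, ← RingHom.map_det]
  rfl

end Arch

end Literature.NumberTheory.Automorphic.UnitaryGroup

end
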